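import Summits.Ventures.Crystal3D.Theorems.StickyWulffConstantTextureBuildMeshV5
import Summits.Ventures.Crystal3D.Theorems.StickyWulffConstantTextureBuildPieceEnergy
import Summits.Ventures.Crystal3D.Theorems.StickyWulffConstantTextureLiminfTentBilayerPrelude
import HarnessLib

/-!
# TB-D assembly, part 6: PIECE DATA — the exact interface between the texture CONSTRUCTION and `stub_TB_energy` (Mesh₄ / Mesh₅ binders)
# (lane T, crux `TextureLiminfV5`, stmt-Ventures-23912; design memo TB-D-0 §7–§8 (P0)–(P2))

HONEST FRAMING. Venture `Summits/Ventures/Crystal3D` (cell `crystal3d-full`), route `route-Ventures-StickyWulffConstant`, helper `--supports` the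
law-v5 crux `TextureLiminfV5` (stmt-Ventures-23912).  One DEFINITION (a structure) and one composition (standard axioms, census-free); no texture
is constructed; rung F-C1 not moved.

`PieceData rc μ` is what the texture construction over a risered cover `rc` and a mesh `μ : Mesh₄ rc δ` must deliver: slab-grain frames and
wall data `(A, c, m)` obeying the three-regime law, a finite family of pairwise disjoint bounded open `H`-polytope PIECES with their slab-grain
labels, the mass inequality for their union, and ONE ledger inequality — the piece ledger of `energy_le_pieceLedger` (…TextureBuildPieceEnergy)
is at most `tentBudget + chargeSum + riserSum + gapCost`.  **`tbEnergy_of_pieceData`**: any `PieceData rc μ` yields the conclusion of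
`stub_TB_energy` for `(rc, μ)` (grains `G ℓ = ⋃_{cls μ = ℓ} P μ`; `IsTexture` from disjointness + `hasFinitePerimeter_polytope`; `vol` is the
volume of the union; `energy` by the piece ledger).  So `stub_TB_energy` = «construct `PieceData rc μ`» (TB-D-0 §8: (T) via `exposedFacetSumIn_le_perKIn`
+ `BarlowFreeCertificate`, (C) via `exists_level_sum_facetArea_le` + `sum_facetArea_inter_le_of_sameSide`, (R), (D), mass), nothing else.
-/

noncomputable section

open scoped BigOperators InnerProductSpace
open MeasureTheory Set

namespace Summit.Ventures.Crystal3D.Cruxes.TextureLiminf.TexShadow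

open Summit.Ventures.Crystal3D Summit.Ventures.Crystal3D.Theorems
open Summit.Ventures.Crystal3D.TentCertificate (hasFinitePerimeter_polytope)
open Literature.Analysis.Convexity (hasFinitePerimeter_iUnion_of_pairwise_disjoint)

/-- **PIECE DATA over a risered cover and a v4 mesh**: the texture construction's deliverable (see the module docstring). -/
structure PieceData {C R₀ : ℝ} {N : ℕ} {x : Fin N → E3} (rc : RiseredCover C R₀ N x) {δ : ℝ} (μ : Mesh₄ rc δ) where
  /-- number of slab grains, their frames and wall data -/
  n : ℕ
  A : Fin n → (E3 ≃ₗᵢ[ℝ] E3)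
  c : Fin n → Fin n → ℝ
  m : Fin n → Fin n → E3
  hc : ∀ ℓ ℓ', ℓ ≠ ℓ' → 0 ≤ c ℓ ℓ'
  hlaw₀ : ∀ ℓ ℓ', ℓ ≠ ℓ' → ¬ CoAx (A ℓ) (A ℓ') → m ℓ ℓ' = 0 ∧ (13 / 25 : ℝ) ≤ c ℓ ℓ'
  hlaw₁ : ∀ ℓ ℓ', ℓ ≠ ℓ' → CoAx (A ℓ) (A ℓ') → A ℓ '' fccRef ≠ A ℓ' '' fccRef →
    SharedAxis (m ℓ ℓ') (A ℓ) (A ℓ') ∧ (1 / 2 : ℝ) ≤ c ℓ ℓ'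
  /-- the pieces and their labels -/
  M : ℕ
  Hp : Fin M → Finset (E3 × ℝ)
  cls : Fin M → Fin n
  hbd : ∀ i, Bornology.IsBounded (polytope (Hp i))
  hunit : ∀ i, ∀ p ∈ Hp i, ‖p.1‖ = 1
  hplanes : ∀ i, ∀ p ∈ Hp i, ∀ p' ∈ Hp i, p ≠ p' → {y : E3 | ⟪p.1, y⟫_ℝ = p.2} ≠ {y : E3 | ⟪p'.1, y⟫_ℝ = p'.2}
  hdisj : ∀ i i', i ≠ i' → Disjoint (polytope (Hp i)) (polytope (Hp i'))
  /-- mass -/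
  hmass : (1 - δ) * (N : ℝ) ≤ Real.sqrt 2 * (volume (⋃ i, polytope (Hp i))).toReal
  /-- the piece ledger is paid by the cover's budgets -/
  hledger : (∑ i, ∑ p ∈ Hp i, supportFn (wulffOf (A (cls i))) p.1 *
        facetArea ((closure (polytope (Hp i)) ∩ {y : E3 | ⟪p.1, y⟫_ℝ = p.2}) \
          ⋃ i' ∈ Finset.univ.erase i, closure (polytope (Hp i'))) p.1) +
      ∑ i, ∑ i' ∈ Finset.univ.filter (fun i' => cls i' ≠ cls i), c (cls i) (cls i') / 2 *
        ∑ p ∈ Hp i, supportFn (wallBody (m (cls i) (cls i'))) p.1 *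
          facetArea (closure (polytope (Hp i)) ∩ {y : E3 | ⟪p.1, y⟫_ℝ = p.2} ∩ closure (polytope (Hp i'))) p.1 ≤
    rc.tentBudget + rc.chargeSum + rc.riserSum + μ.gapCost

namespace PieceData

variable {C R₀ : ℝ} {N : ℕ} {x : Fin N → E3} {rc : RiseredCover C R₀ N x} {δ : ℝ} {μ : Mesh₄ rc δ}

/-- the slab grain `ℓ`: the union of its pieces -/
def G (D : PieceData rc μ) (ℓ : Fin D.n) : Set E3 := ⋃ i ∈ Finset.univ.filter (fun i => D.cls i = ℓ), polytope (D.Hp i)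

/-- The grain is the union over the subtype of its labels. -/
theorem G_eq_iUnion_subtype (D : PieceData rc μ) (ℓ : Fin D.n) :
    D.G ℓ = ⋃ i : {i // D.cls i = ℓ}, polytope (D.Hp i) := by
  ext y
  simp only [G, mem_iUnion, Finset.mem_filter, Finset.mem_univ, true_and, Subtype.exists, exists_prop]

/-- The union of the grains is the union of the pieces. -/
theorem iUnion_G (D : PieceData rc μ) : (⋃ ℓ, D.G ℓ) = ⋃ i, polytope (D.Hp i) := by
  ext y
  simp only [G, mem_iUnion, Finset.mem_filter, Finset.mem_univ, true_and, exists_prop]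
  constructor
  · rintro ⟨ℓ, i, -, hi⟩; exact ⟨i, hi⟩
  · rintro ⟨i, hi⟩; exact ⟨D.cls i, i, rfl, hi⟩

/-- The grains form an admissible texture. -/
theorem isTexture (D : PieceData rc μ) : IsTexture (13 / 25) (1 / 2) D.n D.G D.A D.c D.m := by
  refine ⟨fun ℓ => ⟨?_, ?_⟩, fun ℓ ℓ' hne => ?_, D.hc, D.hlaw₀, D.hlaw₁⟩
  · rw [G_eq_iUnion_subtype]
    exact hasFinitePerimeter_iUnion_of_pairwise_disjoint
      (fun i => hasFinitePerimeter_polytope (D.Hp i) (D.hbd i) (D.hunit i) (D.hplanes i))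
      (fun i i' hii => D.hdisj i i' fun h => hii (Subtype.ext h))
  · rw [G_eq_iUnion_subtype]
    exact (measure_iUnion_fintype_le volume _).trans_lt (ENNReal.sum_lt_top.2 fun i _ => (D.hbd i).measure_lt_top)
  · rw [G_eq_iUnion_subtype, G_eq_iUnion_subtype, Set.disjoint_iUnion_left]
    intro i
    rw [Set.disjoint_iUnion_right]
    intro i'
    exact D.hdisj i i' fun h => hne (i.2.symm.trans (h ▸ i'.2))

/-- **Piece data yield the conclusion of `stub_TB_energy`.** -/
theorem tbEnergy (D : PieceData rc μ) :
    ∃ (n : ℕ) (G : Fin n → Set E3) (A : Fin n → (E3 ≃ₗᵢ[ℝ] E3)) (c : Fin n → Fin n → ℝ) (m : Fin n → Fin n → E3),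
      IsTexture (13 / 25) (1 / 2) n G A c m ∧ (1 - δ) * (N : ℝ) ≤ Real.sqrt 2 * vol n G ∧
      energy n G A c m ≤ rc.tentBudget + rc.chargeSum + rc.riserSum + μ.gapCost := by
  refine ⟨D.n, D.G, D.A, D.c, D.m, D.isTexture, ?_, ?_⟩
  · unfold vol
    rw [iUnion_G]
    exact D.hmass
  · exact (energy_le_pieceLedger D.G D.A D.c D.m D.hc D.Hp D.cls D.hbd D.hunit D.hplanes D.hdisj (fun ℓ => rfl)).trans
      D.hledger

end PieceData

/-- **`stub_TB_energy` from piece data**: a construction of `PieceData rc μ` for every risered cover and v4 mesh proves the stub as registered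
(the two leading hypotheses are not even needed by the composition; the construction uses `BarlowFreeCertificate`). -/
theorem tb_energy_of_pieceData
    (construct : ∀ (C R₀ : ℝ) (N : ℕ) (x : Fin N → E3) (δ : ℝ) (rc : RiseredCover C R₀ N x) (μ : Mesh₄ rc δ), PieceData rc μ) :
    PolytopeCalculus → BarlowFreeCertificate →
      ∀ (C R₀ : ℝ) (N : ℕ) (x : Fin N → E3) (δ : ℝ) (rc : RiseredCover C R₀ N x) (μ : Mesh₄ rc δ),
        ∃ (n : ℕ) (G : Fin n → Set E3) (A : Fin n → (E3 ≃ₗᵢ[ℝ] E3)) (c : Fin n → Fin n → ℝ) (m : Fin n → Fin n → E3),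
          IsTexture (13 / 25) (1 / 2) n G A c m ∧ (1 - δ) * (N : ℝ) ≤ Real.sqrt 2 * vol n G ∧
          energy n G A c m ≤ rc.tentBudget + rc.chargeSum + rc.riserSum + μ.gapCost :=
  fun _ _ C R₀ N x δ rc μ => (construct C R₀ N x δ rc μ).tbEnergy

/-- The same with the construction allowed to use the certificate (the intended use). -/
theorem tb_energy_of_pieceData'
    (construct : BarlowFreeCertificate →
      ∀ (C R₀ : ℝ) (N : ℕ) (x : Fin N → E3) (δ : ℝ) (rc : RiseredCover C R₀ N x) (μ : Mesh₄ rc δ), PieceData rc μ) :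
    PolytopeCalculus → BarlowFreeCertificate →
      ∀ (C R₀ : ℝ) (N : ℕ) (x : Fin N → E3) (δ : ℝ) (rc : RiseredCover C R₀ N x) (μ : Mesh₄ rc δ),
        ∃ (n : ℕ) (G : Fin n → Set E3) (A : Fin n → (E3 ≃ₗᵢ[ℝ] E3)) (c : Fin n → Fin n → ℝ) (m : Fin n → Fin n → E3),
          IsTexture (13 / 25) (1 / 2) n G A c m ∧ (1 - δ) * (N : ℝ) ≤ Real.sqrt 2 * vol n G ∧
          energy n G A c m ≤ rc.tentBudget + rc.chargeSum + rc.riserSum + μ.gapCost :=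
  fun _ hfree C R₀ N x δ rc μ => (construct hfree C R₀ N x δ rc μ).tbEnergy

/-- **`stub_TB_energy` over `Mesh₅` from piece data** (the binders of record after the repair census TB-D-1-g20: `(rc : RiseredCover C R₀ N x) (μ : Mesh₅ rc δ)`):
a construction of `PieceData rc μ.toMesh₄` for every risered cover and v5 mesh, allowed to use the certificate, proves the stub as registered. -/
theorem tb_energy_of_pieceData₅
    (construct : BarlowFreeCertificate →
      ∀ (C R₀ : ℝ) (N : ℕ) (x : Fin N → E3) (δ : ℝ) (rc : RiseredCover C R₀ N x) (μ : Mesh₅ rc δ), PieceData rc μ.toMesh₄) :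
    PolytopeCalculus → BarlowFreeCertificate →
      ∀ (C R₀ : ℝ) (N : ℕ) (x : Fin N → E3) (δ : ℝ) (rc : RiseredCover C R₀ N x) (μ : Mesh₅ rc δ),
        ∃ (n : ℕ) (G : Fin n → Set E3) (A : Fin n → (E3 ≃ₗᵢ[ℝ] E3)) (c : Fin n → Fin n → ℝ) (m : Fin n → Fin n → E3),
          IsTexture (13 / 25) (1 / 2) n G A c m ∧ (1 - δ) * (N : ℝ) ≤ Real.sqrt 2 * vol n G ∧
          energy n G A c m ≤ rc.tentBudget + rc.chargeSum + rc.riserSum + μ.gapCost :=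
  fun _ hfree C R₀ N x δ rc μ => (construct hfree C R₀ N x δ rc μ).tbEnergy

/-- The same with the construction allowed to use ANY proved strengthening of the certificate (e.g. T0's `BarlowFreeCertificateCover`): the
registered binder `BarlowFreeCertificate` then goes idle. -/
theorem tb_energy_of_pieceData₅' {Cert : Prop} (hCert : Cert)
    (construct : Cert →
      ∀ (C R₀ : ℝ) (N : ℕ) (x : Fin N → E3) (δ : ℝ) (rc : RiseredCover C R₀ N x) (μ : Mesh₅ rc δ), PieceData rc μ.toMesh₄) :
    PolytopeCalculus → BarlowFreeCertificate →
      ∀ (C R₀ : ℝ) (N : ℕ) (x : Fin N → E3) (δ : ℝ) (rc : RiseredCover C R₀ N x) (μ : Mesh₅ rc δ),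
        ∃ (n : ℕ) (G : Fin n → Set E3) (A : Fin n → (E3 ≃ₗᵢ[ℝ] E3)) (c : Fin n → Fin n → ℝ) (m : Fin n → Fin n → E3),
          IsTexture (13 / 25) (1 / 2) n G A c m ∧ (1 - δ) * (N : ℝ) ≤ Real.sqrt 2 * vol n G ∧
          energy n G A c m ≤ rc.tentBudget + rc.chargeSum + rc.riserSum + μ.gapCost :=
  fun _ _ C R₀ N x δ rc μ => (construct hCert C R₀ N x δ rc μ).tbEnergy

end Summit.Ventures.Crystal3D.Cruxes.TextureLiminf.TexShadow

end
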